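import Summits.ValiantsHypothesis.ValiantsHypothesis.Theorems.SymPencilSingSixClassificationAntiBlock

/-!
# Route `SymPencil` — SING-SIX CLASSIFICATION, Theorem A (T6′): every `6`-dimensional linear
# subspace of `Sing Z(per₄)` lies in a cross, has two zero rows / columns, or is an exotic
# one-zero-line family `V_λ`, `V^gr` (ᵀ) — VERBATIM port, part 9/10 (`--supports`
# stmt-ValiantsHypothesis-5674 `SdcSuperquadratic`; rung currency only, nothing here bears on `VP ≠ VNP`)

PORT NOTE (val-width-5674-w2 g0′, helper mode; director-valiant R223 (a)): part 9/10 of a VERBATIM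
port of val-idea-18 g3/g4's SORRY-FREE Theorem A of `Cruxes/SdcSuperquadratic/Lines/
sing_six_classification.lean` rev 2.6 (sha256 dfb5f805c61d14b7…; here: `AntiZ` … `fiveDim_crossOrZeroLine`).
ALL mathematics and proofs are val-idea-18's (memo `SING-SIX-CLASSIFICATION.md`); the port changes
only the file split, the linear import chain, the namespace, and one-line docstrings on API lemmas.
NOT ported: the `sorry`-stubs of LIST leaves 3–5 and `sixDim_perDir_list` (leaves 3, 4 = landed
`SymPencilPerFourExoticNoSixSquares` / `SymPencilPerFourCrossFilter`; leaf 5 open).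
  Cut table: see part 1 (`…Defs`).
Honest label: Theorem A of a line, not the crux, not the LIST; `27 ≤ sdc(per₄) ≤ 29` unchanged; stmt-5674
open; `VP ≠ VNP` not moved; no summit statement is proved here. [folklore]
-/

noncomputable section
set_option linter.dupNamespace false
set_option linter.unusedVariables false
set_option linter.unusedSectionVars false

namespace Summit.ValiantsHypothesis.ValiantsHypothesis.Theorems.SymPencilSingSixClassification

open MvPolynomial Module Literature.Computability.AlgebraicComplexity
open Literature.Barriers.CriticalPhenomena.Haruspicy (fin4_cases)
variable {K : Type*} [Field K]

/-- Auxiliary: `AntiZ` (val-idea-18, SING-SIX classification). [folklore] -/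
def AntiZ (i₁ i₂ j₁ j₂ : Fin 4) : Submodule K (Fin 4 × Fin 4 → K) where
  carrier := {x | ∀ i j, ((i = i₁ ∨ i = i₂) ↔ (j = j₁ ∨ j = j₂)) → x (i, j) = 0}
  add_mem' := by
    intro a b ha hb i j hij
    simp [ha i j hij, hb i j hij]
  zero_mem' := by
    intro i j _
    simp
  smul_mem' := by
    intro r a ha i j hij
    simp [ha i j hij]

/-- Auxiliary: `mem_RowZ` (val-idea-18, SING-SIX classification). [folklore] -/
theorem mem_RowZ {i : Fin 4} {x : Fin 4 × Fin 4 → K} : x ∈ RowZ (K := K) i ↔ ∀ j, x (i, j) = 0 :=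
  Iff.rfl
/-- Auxiliary: `mem_ColZ` (val-idea-18, SING-SIX classification). [folklore] -/
theorem mem_ColZ {j : Fin 4} {x : Fin 4 × Fin 4 → K} : x ∈ ColZ (K := K) j ↔ ∀ i, x (i, j) = 0 :=
  Iff.rfl
/-- Auxiliary: `mem_CrossZ` (val-idea-18, SING-SIX classification). [folklore] -/
theorem mem_CrossZ {i₀ j₀ : Fin 4} {x : Fin 4 × Fin 4 → K} :
    x ∈ CrossZ (K := K) i₀ j₀ ↔ ∀ i j, i ≠ i₀ → j ≠ j₀ → x (i, j) = 0 := Iff.rfl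
/-- Auxiliary: `mem_AntiZ` (val-idea-18, SING-SIX classification). [folklore] -/
theorem mem_AntiZ {i₁ i₂ j₁ j₂ : Fin 4} {x : Fin 4 × Fin 4 → K} :
    x ∈ AntiZ (K := K) i₁ i₂ j₁ j₂ ↔
      ∀ i j, ((i = i₁ ∨ i = i₂) ↔ (j = j₁ ∨ j = j₂)) → x (i, j) = 0 := Iff.rfl

/-- Index of the `42` pieces (rows, columns, crosses, proper anti-blocks). -/
abbrev PieceIdx : Type :=
  (Fin 4 ⊕ Fin 4) ⊕ ((Fin 4 × Fin 4) ⊕ {p : Fin 4 × Fin 4 × Fin 4 × Fin 4 // p.1 ≠ p.2.1 ∧ p.2.2.1 ≠ p.2.2.2})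

/-- The pieces. -/
def piece : PieceIdx → Submodule K (Fin 4 × Fin 4 → K) :=
  Sum.elim (Sum.elim RowZ ColZ)
    (Sum.elim (fun c => CrossZ c.1 c.2) (fun p => AntiZ p.1.1 p.1.2.1 p.1.2.2.1 p.1.2.2.2))

/-- Part A pointwise: every element of `W ⊆ Sing` lies in one of the pieces. -/
theorem mem_piece_of_sing3 {W : Submodule K (Fin 4 × Fin 4 → K)} (hS : Sing3 W)
    (h12 : (12 : K) ≠ 0) {x : Fin 4 × Fin 4 → K} (hx : x ∈ W) : ∃ k : PieceIdx, x ∈ piece (K := K) k := by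
  have h := Summit.ValiantsHypothesis.ValiantsHypothesis.Theorems.SymPencilPerFourSingularLocusSupportPatterns.support_of_subperm_vanish
    h12 (Matrix.of fun i j => x (i, j))
    (fun r c => hS x hx _ _ Fin.succAbove_right_injective Fin.succAbove_right_injective)
  rcases h with ⟨i, hi⟩ | ⟨j, hj⟩ | ⟨i₁, i₂, j₁, j₂, h₁, h₂, hA⟩ | ⟨i₀, j₀, hC⟩
  · exact ⟨Sum.inl (Sum.inl i), fun j => hi j⟩
  · exact ⟨Sum.inl (Sum.inr j), fun i => hj i⟩
  · exact ⟨Sum.inr (Sum.inr ⟨(i₁, i₂, j₁, j₂), h₁, h₂⟩), fun i j hij => hA i j hij⟩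
  · exact ⟨Sum.inr (Sum.inl (i₀, j₀)), fun i j hi hj => hC i j hi hj⟩

/-- **LEAF 1 — ZERO-LINE LEMMA — PROVED** (rev 2.6; the statement of rev 1's `stub_zeroLine`,
VERBATIM; memo §2).  A linear subspace of `Sing Z(per₄)` of dimension `≥ 5` lies in a cross or has an
identically-zero row or column.  Part A (`SymPencilPerFourSingularLocusSupportPatterns.
support_of_subperm_vanish`, p615473) puts every `x ∈ W` inside one of the `42` coordinate subspaces
`piece` (4 rows, 4 columns, 16 crosses, 18 proper anti-blocks); a vector space over an infinite field
is not a finite union of proper subspaces (`Submodule.exists_forall_notMem_of_forall_ne_top`), so `W`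
lies in ONE piece; rows / columns / crosses are conclusions, and a proper anti-block `[[0,P],[Q,0]]`
is `anti_case` (zero row, since `dim W ≥ 5 > 2 + 2`). [folklore] -/
theorem zeroLine [CharZero K] :
    ∀ W : Submodule K (Fin 4 × Fin 4 → K), Sing3 W → 5 ≤ finrank K W →
      InCross W ∨ (∃ i : Fin 4, ∀ x ∈ W, ∀ j : Fin 4, x (i, j) = 0) ∨
        (∃ j : Fin 4, ∀ x ∈ W, ∀ i : Fin 4, x (i, j) = 0) := by
  intro W hS h5
  have h12 : (12 : K) ≠ 0 := by norm_num
  by_contra hnot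
  have hne : ∀ k : PieceIdx, (piece (K := K) k).comap W.subtype ≠ ⊤ := by
    intro k hk
    have hall : ∀ x ∈ W, x ∈ piece (K := K) k := fun x hx => by
      have hmem : (⟨x, hx⟩ : W) ∈ (piece (K := K) k).comap W.subtype := by
        rw [hk]; exact Submodule.mem_top
      exact hmem
    rcases k with (i | j) | (c | p)
    · exact hnot (Or.inr (Or.inl ⟨i, fun x hx j => (mem_RowZ.mp (hall x hx)) j⟩))
    · exact hnot (Or.inr (Or.inr ⟨j, fun x hx i => (mem_ColZ.mp (hall x hx)) i⟩))
    · exact hnot (Or.inl ⟨c.1, c.2, fun x hx i j hi hj => (mem_CrossZ.mp (hall x hx)) i j hi hj⟩)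
    · exact hnot (Or.inr (Or.inl (anti_case hS h5 p.2.1 p.2.2
        (fun x hx => mem_AntiZ.mp (hall x hx)))))
  obtain ⟨x, hx⟩ := Submodule.exists_forall_notMem_of_forall_ne_top
    (fun k : PieceIdx => (piece (K := K) k).comap W.subtype) hne
  obtain ⟨k, hk⟩ := mem_piece_of_sing3 hS h12 x.2
  exact hx k hk

/-- **`caseFour_of`** (PROVED): the case `n_r = 4` from the kernel-plane types and the three sub-cases. -/
theorem caseFour_of [CharZero K] (hP : PerpPlanes K) (hPure : CasePure K) (hProd : CaseProduct K)
    (hGraph : CaseGraph K) : CaseFour K := by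
  intro W ρ hN hρ htop
  obtain ⟨hS, h6, h0⟩ := hN
  have h02 : (0 : Fin 4) ≠ ρ 2 := by rw [← hρ]; exact fun h => by simpa using ρ.injective h
  have h03 : (0 : Fin 4) ≠ ρ 3 := by rw [← hρ]; exact fun h => by simpa using ρ.injective h
  have h12 : ρ 1 ≠ ρ 2 := fun h => by simpa using ρ.injective h
  have h13 : ρ 1 ≠ ρ 3 := fun h => by simpa using ρ.injective h
  have h23 : ρ 2 ≠ ρ 3 := fun h => by simpa using ρ.injective h
  set D : Submodule K (Fin 4 × Fin 4 → K) := W ⊓ LinearMap.ker (rowL (K := K) (ρ 1)) with hD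
  -- rows other than `ρ 2, ρ 3` vanish on `D`
  have hrows : ∀ d ∈ D, ∀ i, i ≠ ρ 2 → i ≠ ρ 3 → row d i = 0 := by
    intro d hd i hi2 hi3
    rw [mem_kerPlane] at hd
    rcases fin4_of_perm ρ i with rfl | rfl | rfl | rfl
    · rw [hρ]; exact h0 d hd.1
    · exact hd.2
    · exact absurd rfl hi2
    · exact absurd rfl hi3
  have hD2 : finrank K D = 2 := finrank_kerPlane h6 htop
  -- every element of `D` is a perm-orthogonal pair of rows (POLARISATION)
  have hperp : ∀ d ∈ D, PermOrth (row d (ρ 2)) (row d (ρ 3)) := by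
    intro d hd
    rw [mem_kerPlane] at hd
    refine permOrth_of_T3 fun u l => ?_
    have hu : u ∈ W.map (rowL (ρ 1)) := by rw [htop]; exact Submodule.mem_top
    obtain ⟨x, hx, rfl⟩ := Submodule.mem_map.mp hu
    exact polar hS h12 h13 h23 hx hd.1 hd.2 l
  have hKiff : ∀ k, (k ∈ W ∧ row k (ρ 1) = 0) ↔ k ∈ D := fun k => mem_kerPlane.symm
  rcases hP D (ρ 2) (ρ 3) h23 hrows (by omega) hperp with hPv | hPw | ⟨-, hProdT | hGraphT⟩
  · -- row `ρ 2` vanishes on `K_r`: pure case ⇒ rows `0, ρ 2` vanish on `W`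
    have hW : ∀ x ∈ W, row x (ρ 2) = 0 :=
      hPure W ρ ⟨hS, h6, h0⟩ hρ htop fun k hk hkr => hPv k (mem_kerPlane.mpr ⟨hk, hkr⟩)
    refine Or.inr (Or.inl ⟨0, ρ 2, h02, fun x hx j => ⟨?_, ?_⟩⟩)
    · exact congrFun (h0 x hx) j
    · exact congrFun (hW x hx) j
  · -- row `ρ 3` vanishes on `K_r`: pure case with `ρ ∘ (2 3)`
    have e0 : ((Equiv.swap (2 : Fin 4) 3).trans ρ) 0 = 0 := by
      simp [Equiv.swap_apply_of_ne_of_ne, hρ]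
    have e1 : ((Equiv.swap (2 : Fin 4) 3).trans ρ) 1 = ρ 1 := by
      simp [Equiv.swap_apply_of_ne_of_ne]
    have e2 : ((Equiv.swap (2 : Fin 4) 3).trans ρ) 2 = ρ 3 := by simp
    have hW : ∀ x ∈ W, row x (ρ 3) = 0 := by
      have := hPure W ((Equiv.swap (2 : Fin 4) 3).trans ρ) ⟨hS, h6, h0⟩ e0 (by rw [e1]; exact htop)
        (fun k hk hkr => by
          rw [e2]; rw [e1] at hkr; exact hPw k (mem_kerPlane.mpr ⟨hk, hkr⟩))
      rw [e2] at this
      exact this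
    refine Or.inr (Or.inl ⟨0, ρ 3, h03, fun x hx j => ⟨?_, ?_⟩⟩)
    · exact congrFun (h0 x hx) j
    · exact congrFun (hW x hx) j
  · obtain ⟨j, c, α, β, hjc, hαβ, hmem⟩ := hProdT
    rcases hProd W ρ j c α β ⟨hS, h6, h0⟩ hρ htop hjc hαβ (fun k => (hKiff k).trans (hmem k)) with
      hV | hX
    · exact Or.inr (Or.inr (Or.inr (Or.inl hV)))
    · exact Or.inl hX
  · obtain ⟨j, c, e, hjc, he, hmem⟩ := hGraphT
    have hV := hGraph W ρ j c e ⟨hS, h6, h0⟩ hρ htop hjc he (fun k => (hKiff k).trans (hmem k))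
    exact Or.inr (Or.inr (Or.inr (Or.inr (Or.inl hV))))

/-- The TORIC ENVELOPE `{x : row₀ x = 0, rowᵢ x ∈ Aᵢ (i ≠ 0)}` of `W` (used for `ToricStructure`). -/
def toricEnvelope (W : Submodule K (Fin 4 × Fin 4 → K)) : Submodule K (Fin 4 × Fin 4 → K) where
  carrier := {x | row x 0 = 0 ∧ ∀ i : Fin 4, i ≠ 0 → row x i ∈ W.map (rowL i)}
  add_mem' := by
    rintro x y ⟨hx0, hx⟩ ⟨hy0, hy⟩
    refine ⟨by rw [row_add, hx0, hy0, add_zero], fun i hi => ?_⟩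
    rw [row_add]
    exact Submodule.add_mem _ (hx i hi) (hy i hi)
  zero_mem' := ⟨rfl, fun i hi => Submodule.zero_mem _⟩
  smul_mem' := by
    rintro c x ⟨hx0, hx⟩
    refine ⟨by rw [row_smul, hx0, smul_zero], fun i hi => ?_⟩
    rw [row_smul]
    exact Submodule.smul_mem _ c (hx i hi)

/-- Auxiliary: `mem_toricEnvelope` (val-idea-18, SING-SIX classification). [folklore] -/
theorem mem_toricEnvelope {W : Submodule K (Fin 4 × Fin 4 → K)} {x : Fin 4 × Fin 4 → K} :
    x ∈ toricEnvelope W ↔ row x 0 = 0 ∧ ∀ i : Fin 4, i ≠ 0 → row x i ∈ W.map (rowL i) :=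
  Iff.rfl

/-- Auxiliary: `le_toricEnvelope` (val-idea-18, SING-SIX classification). [folklore] -/
theorem le_toricEnvelope {W : Submodule K (Fin 4 × Fin 4 → K)} (h0 : ∀ x ∈ W, row x 0 = 0) :
    W ≤ toricEnvelope W :=
  fun x hx => ⟨h0 x hx, fun i hi => Submodule.mem_map_of_mem hx⟩

/-- `dim (toric envelope) ≤ n₁ + n₂ + n₃` (it embeds into `A₁ × A₂ × A₃`). -/
theorem finrank_toricEnvelope_le (W : Submodule K (Fin 4 × Fin 4 → K)) :
    finrank K (toricEnvelope W) ≤ finrank K (W.map (rowL 1)) +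
      (finrank K (W.map (rowL 2)) + finrank K (W.map (rowL 3))) := by
  obtain ⟨F, hF⟩ : ∃ F : toricEnvelope W →ₗ[K]
      (↥(W.map (rowL (K := K) 1)) × (↥(W.map (rowL (K := K) 2)) × ↥(W.map (rowL (K := K) 3)))),
      Function.Injective F := by
    refine ⟨LinearMap.prod
        (LinearMap.codRestrict _ ((rowL 1).comp (toricEnvelope W).subtype) fun x =>
          (mem_toricEnvelope.mp x.2).2 1 (by decide))
        (LinearMap.prod
          (LinearMap.codRestrict _ ((rowL 2).comp (toricEnvelope W).subtype) fun x =>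
            (mem_toricEnvelope.mp x.2).2 2 (by decide))
          (LinearMap.codRestrict _ ((rowL 3).comp (toricEnvelope W).subtype) fun x =>
            (mem_toricEnvelope.mp x.2).2 3 (by decide))), fun x y hxy => ?_⟩
    have e1 : row (x : Fin 4 × Fin 4 → K) 1 = row (y : Fin 4 × Fin 4 → K) 1 :=
      congrArg (fun z => ((z.1 : ↥(W.map (rowL (K := K) 1))) : Fin 4 → K)) hxy
    have e2 : row (x : Fin 4 × Fin 4 → K) 2 = row (y : Fin 4 × Fin 4 → K) 2 :=
      congrArg (fun z => ((z.2.1 : ↥(W.map (rowL (K := K) 2))) : Fin 4 → K)) hxy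
    have e3 : row (x : Fin 4 × Fin 4 → K) 3 = row (y : Fin 4 × Fin 4 → K) 3 :=
      congrArg (fun z => ((z.2.2 : ↥(W.map (rowL (K := K) 3))) : Fin 4 → K)) hxy
    apply Subtype.ext
    funext ⟨i, j⟩
    have hx0 := (mem_toricEnvelope.mp x.2).1
    have hy0 := (mem_toricEnvelope.mp y.2).1
    rcases fin4_cases i with rfl | rfl | rfl | rfl
    · exact (congrFun hx0 j).trans (congrFun hy0 j).symm
    · exact congrFun e1 j
    · exact congrFun e2 j
    · exact congrFun e3 j
  calc finrank K (toricEnvelope W)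
      ≤ finrank K (↥(W.map (rowL (K := K) 1)) × (↥(W.map (rowL (K := K) 2)) × ↥(W.map (rowL (K := K) 3)))) :=
        LinearMap.finrank_le_finrank_of_injective hF
    _ = _ := by rw [Module.finrank_prod, Module.finrank_prod]

/-- **§3.8 TORIC PRODUCT STRUCTURE — PROVED** (rev 2.1; was `stub_toricStructure`). -/
theorem toricStructure : ToricStructure K := by
  intro W h6 h0 hle
  have hWV : W ≤ toricEnvelope W := le_toricEnvelope h0
  have hWle : finrank K W ≤ finrank K (toricEnvelope W) := Submodule.finrank_mono hWV
  have hV := finrank_toricEnvelope_le W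
  have h1 := hle 1 (by decide)
  have h2 := hle 2 (by decide)
  have h3 := hle 3 (by decide)
  have n1 : finrank K (W.map (rowL 1)) = 2 := by omega
  have n2 : finrank K (W.map (rowL 2)) = 2 := by omega
  have n3 : finrank K (W.map (rowL 3)) = 2 := by omega
  refine ⟨fun i hi => ?_, fun x hx0 hx => ?_⟩
  · rcases fin4_cases i with rfl | rfl | rfl | rfl
    · exact absurd rfl hi
    · exact n1
    · exact n2
    · exact n3
  · have hEq : W = toricEnvelope W := Submodule.eq_of_le_of_finrank_le hWV (by omega)
    rw [hEq]
    exact ⟨hx0, hx⟩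

/-- The `4 × 4` array with rows `0, a₁, a₂, a₃`. -/
def mk4 (a₁ a₂ a₃ : Fin 4 → K) : Fin 4 × Fin 4 → K :=
  fun ij => ![(0 : Fin 4 → K), a₁, a₂, a₃] ij.1 ij.2

/-- Auxiliary: `row_mk4_zero` (val-idea-18, SING-SIX classification). [folklore] -/
@[simp] theorem row_mk4_zero (a₁ a₂ a₃ : Fin 4 → K) : row (mk4 a₁ a₂ a₃) 0 = 0 := rfl
/-- Auxiliary: `row_mk4_one` (val-idea-18, SING-SIX classification). [folklore] -/
@[simp] theorem row_mk4_one (a₁ a₂ a₃ : Fin 4 → K) : row (mk4 a₁ a₂ a₃) 1 = a₁ := rfl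
/-- Auxiliary: `row_mk4_two` (val-idea-18, SING-SIX classification). [folklore] -/
@[simp] theorem row_mk4_two (a₁ a₂ a₃ : Fin 4 → K) : row (mk4 a₁ a₂ a₃) 2 = a₂ := rfl
/-- Auxiliary: `row_mk4_three` (val-idea-18, SING-SIX classification). [folklore] -/
@[simp] theorem row_mk4_three (a₁ a₂ a₃ : Fin 4 → K) : row (mk4 a₁ a₂ a₃) 3 = a₃ := rfl

/-- Row spaces have dimension `≤ 4`. -/
theorem finrank_rowSpace_le (W : Submodule K (Fin 4 × Fin 4 → K)) (i : Fin 4) :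
    finrank K (W.map (rowL i)) ≤ 4 := by
  calc finrank K (W.map (rowL i)) ≤ finrank K (Fin 4 → K) := Submodule.finrank_le _
    _ = 4 := Module.finrank_fin_fun K

/-- **`residueNorm_of`** (PROVED): the normal-form residue theorem from the three cases
(trichotomy on the live row-space dimensions + the toric glue). -/
theorem residueNorm_of [CharZero K] (h4 : CaseFour K) (h3 : CaseThree K) (hT : ToricStructure K)
    (hTT : ToricTriple K) : ResidueNorm K := by
  intro W hN
  obtain ⟨hS, h6, h0⟩ := hN
  by_cases hex4 : ∃ i : Fin 4, i ≠ 0 ∧ W.map (rowL i) = ⊤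
  · obtain ⟨i, hi, htop⟩ := hex4
    refine h4 W (Equiv.swap 1 i) ⟨hS, h6, h0⟩ ?_ (by simpa using htop)
    exact Equiv.swap_apply_of_ne_of_ne (by decide) hi.symm
  push Not at hex4
  have hle3 : ∀ i : Fin 4, i ≠ 0 → finrank K (W.map (rowL i)) ≤ 3 := by
    intro i hi
    have hle := finrank_rowSpace_le W i
    rcases Nat.lt_or_ge (finrank K (W.map (rowL i))) 4 with h | h
    · omega
    · exfalso
      refine hex4 i hi (Submodule.eq_top_of_finrank_eq ?_)
      rw [Module.finrank_fin_fun]; omega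
  by_cases hex3 : ∃ i : Fin 4, i ≠ 0 ∧ finrank K (W.map (rowL i)) = 3
  · obtain ⟨i, hi, h3i⟩ := hex3
    have hTZ := h3 W (Equiv.swap 1 i) ⟨hS, h6, h0⟩
      (Equiv.swap_apply_of_ne_of_ne (by decide) hi.symm) hle3 (by rw [Equiv.swap_apply_left]; exact h3i)
    exact Or.inr (Or.inl hTZ)
  push Not at hex3
  have hle2 : ∀ i : Fin 4, i ≠ 0 → finrank K (W.map (rowL i)) ≤ 2 := by
    intro i hi
    have := hle3 i hi
    have := hex3 i hi
    omega
  -- toric case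
  obtain ⟨hdim, hprod⟩ := hT W h6 h0 hle2
  have hvan : ∀ a₁ ∈ W.map (rowL 1), ∀ a₂ ∈ W.map (rowL 2), ∀ a₃ ∈ W.map (rowL 3), ∀ l,
      T3 a₁ a₂ a₃ l = 0 := by
    intro a₁ h₁ a₂ h₂ a₃ h₃ l
    have hx : mk4 a₁ a₂ a₃ ∈ W := by
      refine hprod _ (row_mk4_zero _ _ _) fun i hi => ?_
      rcases fin4_of_perm (Equiv.refl _) i with rfl | rfl | rfl | rfl
      · exact absurd rfl hi
      · simpa using h₁
      · simpa using h₂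
      · simpa using h₃
    simpa using T3_eq_zero_of_sing3 hS hx 1 2 3 (by decide) (by decide) (by decide) l
  obtain ⟨p, q, hpq, hA₁, hA₂, hA₃⟩ :=
    hTT _ _ _ (hdim 1 (by decide)) (hdim 2 (by decide)) (hdim 3 (by decide)) hvan
  refine Or.inr (Or.inr (Or.inl ⟨p, q, hpq, fun x hx i => ?_⟩))
  by_cases hi : i = 0
  · subst hi; exact ⟨congrFun (h0 x hx) p, congrFun (h0 x hx) q⟩
  · have hm : row x i ∈ W.map (rowL i) := Submodule.mem_map_of_mem hx
    rcases fin4_of_perm (Equiv.refl _) i with rfl | rfl | rfl | rfl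
    · exact absurd rfl hi
    · exact hA₁ _ (by simpa using hm)
    · exact hA₂ _ (by simpa using hm)
    · exact hA₃ _ (by simpa using hm)

/-- **Leaf 2 assembled** (PROVED): the one-zero-line residue from `Transport` and the cases. -/
theorem zeroLineResidue_of [CharZero K] (hTr : Transport K) (h4 : CaseFour K) (h3 : CaseThree K)
    (hT : ToricStructure K) (hTT : ToricTriple K) :
    ∀ W : Submodule K (Fin 4 × Fin 4 → K), Sing3 W → finrank K W = 6 →
      ((∃ i : Fin 4, ∀ x ∈ W, ∀ j : Fin 4, x (i, j) = 0) ∨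
        (∃ j : Fin 4, ∀ x ∈ W, ∀ i : Fin 4, x (i, j) = 0)) →
      InCross W ∨ TwoZeroRows W ∨ TwoZeroCols W ∨
        VLambdaRows W ∨ VGraphRows W ∨ VLambdaCols W ∨ VGraphCols W :=
  hTr (residueNorm_of h4 h3 hT hTT)

/-- **LEAF 2 — PROVED** (rev 2.5): the statement of rev 1's `stub_zeroLineResidue`, VERBATIM, with NO
`sorry` in its dependency cone (`permOrthPairs`, `toricStructure`, `transport`, the four CASES,
`productAbsorb`, `graphAbsorb_of`, `pureCore`, `perpPlanes`, `toricTriple`: revs 2.1–2.5). -/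
theorem zeroLineResidue [CharZero K] :
    ∀ W : Submodule K (Fin 4 × Fin 4 → K), Sing3 W → finrank K W = 6 →
      ((∃ i : Fin 4, ∀ x ∈ W, ∀ j : Fin 4, x (i, j) = 0) ∨
        (∃ j : Fin 4, ∀ x ∈ W, ∀ i : Fin 4, x (i, j) = 0)) →
      InCross W ∨ TwoZeroRows W ∨ TwoZeroCols W ∨
        VLambdaRows W ∨ VGraphRows W ∨ VLambdaCols W ∨ VGraphCols W :=
  zeroLineResidue_of transport
    (caseFour_of (perpPlanes permOrthPairs)
      (casePure_of pureCore)
      (caseProduct_of productAbsorb) (caseGraph_of (graphAbsorb_of productAbsorb)))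
    (caseThree_of (perpPlanes permOrthPairs))
    toricStructure (toricTriple permOrthPairs)

/-- **T6′ — classification of the `6`-dimensional linear subspaces of `Sing Z(per₄)`** from leaves 1–2
(composition; the unconditional instance is `sixDim_classification` below). -/
theorem sixDim_classification_of [CharZero K]
    (h1 : ∀ W : Submodule K (Fin 4 × Fin 4 → K), Sing3 W → 5 ≤ finrank K W →
      InCross W ∨ (∃ i : Fin 4, ∀ x ∈ W, ∀ j : Fin 4, x (i, j) = 0) ∨
        (∃ j : Fin 4, ∀ x ∈ W, ∀ i : Fin 4, x (i, j) = 0))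
    (h2 : ∀ W : Submodule K (Fin 4 × Fin 4 → K), Sing3 W → finrank K W = 6 →
      ((∃ i : Fin 4, ∀ x ∈ W, ∀ j : Fin 4, x (i, j) = 0) ∨
        (∃ j : Fin 4, ∀ x ∈ W, ∀ i : Fin 4, x (i, j) = 0)) →
      InCross W ∨ TwoZeroRows W ∨ TwoZeroCols W ∨
        VLambdaRows W ∨ VGraphRows W ∨ VLambdaCols W ∨ VGraphCols W) :
    ∀ W : Submodule K (Fin 4 × Fin 4 → K), Sing3 W → finrank K W = 6 →
      InCross W ∨ TwoZeroRows W ∨ TwoZeroCols W ∨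
        VLambdaRows W ∨ VGraphRows W ∨ VLambdaCols W ∨ VGraphCols W := by
  intro W hS h6
  rcases h1 W hS (by omega) with hX | hrow | hcol
  · exact Or.inl hX
  · exact h2 W hS h6 (Or.inl hrow)
  · exact h2 W hS h6 (Or.inr hcol)

/-- **THEOREM A (T6′) — PROVED, no hypotheses, no `sorry`** (rev 2.6).  Over a field of
characteristic `0`, every `6`-dimensional linear subspace `W` of `Sing Z(per₄)` (all `3 × 3`
subpermanents vanish on `W`) lies in a cross, or has two identically-zero rows, or two identically-zero
columns, or is one of the exotic one-zero-line families `V_Λ` / `V_gr` (rows or columns).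
`sixDim_classification_of zeroLine zeroLineResidue`; `#print axioms`: `propext`, `Classical.choice`,
`Quot.sound`.  (Not a lower bound: the LIST below still rests on leaves 3–5.) -/
theorem sixDim_classification [CharZero K] :
    ∀ W : Submodule K (Fin 4 × Fin 4 → K), Sing3 W → finrank K W = 6 →
      InCross W ∨ TwoZeroRows W ∨ TwoZeroCols W ∨
        VLambdaRows W ∨ VGraphRows W ∨ VLambdaCols W ∨ VGraphCols W :=
  sixDim_classification_of zeroLine zeroLineResidue

/-- Corollary (T5): a `5`-dimensional `W ⊆ Sing Z(per₄)` already lies in a cross or has a zero line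
(`zeroLine` is stated for `dim ≥ 5`). -/
theorem fiveDim_crossOrZeroLine [CharZero K] (W : Submodule K (Fin 4 × Fin 4 → K)) (hS : Sing3 W)
    (h5 : 5 ≤ finrank K W) :
    InCross W ∨ (∃ i : Fin 4, ∀ x ∈ W, ∀ j : Fin 4, x (i, j) = 0) ∨
      (∃ j : Fin 4, ∀ x ∈ W, ∀ i : Fin 4, x (i, j) = 0) :=
  zeroLine W hS h5

end Summit.ValiantsHypothesis.ValiantsHypothesis.Theorems.SymPencilSingSixClassification

end
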